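import Mathlib
import HarnessLib
import Summits.HubbardSuperconductivity.HubbardSuperconductivity.Theorems.KLProgrammeKLRegimeVolumeLimitSunsetFrequencySum

/-!
# Route `KLProgramme` — VL child `KLRegimeVolumeLimitV12` (stmt-HubbardSuperconductivity-19858), order-`U²` rung of the CAUCHY
# stub `stub_vl_twoVolumeRate`: the two-loop (sunset) Matsubara double sum has TAILS that are small UNIFORMLY in the external
# frequency (cell gate-hubbard-kl, seat hubbard-kl-k3c4-p1 g4; companion of `…VolumeLimitSunsetFrequencySum`)

WHY.  The registered Cauchy stub of the VL skeleton «cauchy» compares the carrier at two volumes `(L, M)` and `(L′, M′)` at the SAME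
fermionic Matsubara integer `n` and asks for a rate `ρ L` that does not see `n`.  At order `U²` the carrier is the sunset double sum over
internal Matsubara integers `(a, b)` of terms of size `≍ (|a+½| |b+½| |n+b-a+½|)⁻¹`, KEPT only when `a`, `b`, `n+b-a` are among the
`2M` labels `[-M, M-1]` (`…VolumeLimitSunset.klSunsetTerm`).  Two different cutoffs `M ≠ M′` keep different label sets, so the two-volume
difference contains, besides the Riemann-sum part, the MISMATCH part: the terms kept at one cutoff and not at the other.  A label that is
not kept at cutoff `M` has `|· + ½| ≥ M + ½`, so the mismatch is controlled by the tail

  `T_R(n) = Σ_{(a,b) : max(|a+½|, |b+½|, |n+b-a+½|) ≥ R} (|a+½| |b+½| |n+b-a+½|)⁻¹`,   `R = M + ½`,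

and what the Cauchy stub needs is `sup_n T_R(n) → 0` as `R → ∞`.  (The per-Matsubara-integer VL text needed only `T_R(n) → 0` for each
`n`, which is dominated convergence; the family has NO `n`-uniform summable termwise majorant — `Σ_{a,b} sup_n (…) = ∞` — so uniformity
in `n` is a genuine extra.)  It holds with an explicit rate and is proved here by the device of `…SunsetFrequencySum` («drop the largest
factor») run at the exponent `11/8` instead of `3/2`: for positive reals with `x, y ≤ z` and `R ≤ z`,

  `(xyz)⁻¹ ≤ R^{-1/4} · x^{-11/8} · y^{-11/8}`      (`z = z^{1/4} z^{3/8} z^{3/8} ≥ R^{1/4} x^{3/8} y^{3/8}`),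

so that, whichever of the three factors is the largest (it is then `≥ R`), the term is at most `R^{-1/4}` times a sum of three products
`h(·)h(·)`, `h(t) = t^{-11/8}`, and after the two integer shears of `ℤ²` each product family sums to `H²`, `H = Σ_{a ∈ ℤ} |a+½|^{-11/8} < ∞`:

* `klst_inv_mul_three_le_of_le` — the pointwise inequality with threshold;
* `klst_inv_mul_three_le_of_le_max` — drop the largest factor when the largest is `≥ R`;
* `klst_summable_h`, `klst_hasSum_prod` — `H < ∞` (`p`-series, `p = 11/8`) and the product family;
* **`klst_tsum_sunsetWeight_indicator_le`** — for every `n ∈ ℤ`, `R > 0` and every (decidable) label set `P ⊆ ℤ²` on which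
  `max(|a+½|, |b+½|, |n+b-a+½|) ≥ R`:  `Σ_{(a,b) ∈ P} (|a+½| |b+½| |n+b-a+½|)⁻¹ ≤ R^{-1/4} · 3H²` (bound independent of `n`);
* `klst_half_le_abs_of_not_mem_Icc` — a label outside `[-M, M-1]` has `|· + ½| ≥ M + ½` (the bridge to the kept sets of `klSunsetTerm`).

Pure real analysis (Mathlib); nothing is asserted about the model.  Reference for the role of the bound: G. Benfatto, A. Giuliani,
V. Mastropietro, Ann. Henri Poincaré 7 (2006) 809–898, §2.1 (2.3)–(2.8), §2.4 (finite-temperature perturbation theory on the space-time torus,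
ultraviolet Matsubara truncation and its removal).
-/

noncomputable section

namespace Summit.HubbardSuperconductivity.HubbardSuperconductivity.Theorems.KLRegimeSplit

set_option linter.dupNamespace false -- summit = problem name (single-conjunct summit), D-0017

open Real

/-! ## §1 The pointwise inequality with a threshold -/

/-- `t · t^{3/8} = t^{11/8}` for `t > 0`. -/
theorem klst_mul_rpow_three_eighths {t : ℝ} (ht : 0 < t) : t * t ^ ((3 : ℝ) / 8) = t ^ ((11 : ℝ) / 8) := by
  rw [show ((11 : ℝ) / 8) = 1 + 3 / 8 by norm_num, Real.rpow_add ht, Real.rpow_one]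

/-- `z = z^{1/4} · z^{3/8} · z^{3/8}` for `z > 0`. -/
theorem klst_rpow_split {z : ℝ} (hz : 0 < z) : z ^ ((1 : ℝ) / 4) * z ^ ((3 : ℝ) / 8) * z ^ ((3 : ℝ) / 8) = z := by
  rw [← Real.rpow_add hz, ← Real.rpow_add hz, show ((1 : ℝ) / 4 + 3 / 8 + 3 / 8) = 1 by norm_num, Real.rpow_one]

/-- **Drop the largest factor, with a threshold.**  If `x, y ≤ z` and `R ≤ z` (all positive) then
`(xyz)⁻¹ ≤ (R^{1/4})⁻¹ · (x^{11/8})⁻¹ · (y^{11/8})⁻¹`. -/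
theorem klst_inv_mul_three_le_of_le {x y z R : ℝ} (hx : 0 < x) (hy : 0 < y) (hR : 0 < R) (hxz : x ≤ z) (hyz : y ≤ z)
    (hRz : R ≤ z) :
    (x * y * z)⁻¹ ≤ (R ^ ((1 : ℝ) / 4))⁻¹ * ((x ^ ((11 : ℝ) / 8))⁻¹ * (y ^ ((11 : ℝ) / 8))⁻¹) := by
  have hz : 0 < z := hx.trans_le hxz
  rw [← mul_inv, ← mul_inv]
  apply inv_anti₀ (by positivity)
  have h1 : R ^ ((1 : ℝ) / 4) ≤ z ^ ((1 : ℝ) / 4) := Real.rpow_le_rpow hR.le hRz (by norm_num)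
  have h2 : x ^ ((3 : ℝ) / 8) ≤ z ^ ((3 : ℝ) / 8) := Real.rpow_le_rpow hx.le hxz (by norm_num)
  have h3 : y ^ ((3 : ℝ) / 8) ≤ z ^ ((3 : ℝ) / 8) := Real.rpow_le_rpow hy.le hyz (by norm_num)
  calc R ^ ((1 : ℝ) / 4) * (x ^ ((11 : ℝ) / 8) * y ^ ((11 : ℝ) / 8))
      = x * y * (R ^ ((1 : ℝ) / 4) * x ^ ((3 : ℝ) / 8) * y ^ ((3 : ℝ) / 8)) := by
        rw [← klst_mul_rpow_three_eighths hx, ← klst_mul_rpow_three_eighths hy]; ring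
    _ ≤ x * y * (z ^ ((1 : ℝ) / 4) * z ^ ((3 : ℝ) / 8) * z ^ ((3 : ℝ) / 8)) := by
        gcongr
    _ = x * y * z := by rw [klst_rpow_split hz]

/-- The weight `h(t) = (t^{11/8})⁻¹` is nonnegative for `t ≥ 0`. -/
theorem klst_h_nonneg {t : ℝ} (ht : 0 ≤ t) : 0 ≤ (t ^ ((11 : ℝ) / 8))⁻¹ := by positivity

/-- **Drop the largest factor when the largest is at least `R`.**  For positive `x, y, z` with `R ≤ max(x, y, z)`:
`(xyz)⁻¹ ≤ (R^{1/4})⁻¹ · (h x · h y + h x · h z + h y · h z)`, `h t = (t^{11/8})⁻¹`. -/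
theorem klst_inv_mul_three_le_of_le_max {x y z R : ℝ} (hx : 0 < x) (hy : 0 < y) (hz : 0 < z) (hR : 0 < R)
    (hmax : R ≤ max x (max y z)) :
    (x * y * z)⁻¹ ≤ (R ^ ((1 : ℝ) / 4))⁻¹ *
      ((x ^ ((11 : ℝ) / 8))⁻¹ * (y ^ ((11 : ℝ) / 8))⁻¹ + (x ^ ((11 : ℝ) / 8))⁻¹ * (z ^ ((11 : ℝ) / 8))⁻¹ +
        (y ^ ((11 : ℝ) / 8))⁻¹ * (z ^ ((11 : ℝ) / 8))⁻¹) := by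
  have hRi : 0 ≤ (R ^ ((1 : ℝ) / 4))⁻¹ := by positivity
  have h1 : 0 ≤ (x ^ ((11 : ℝ) / 8))⁻¹ * (y ^ ((11 : ℝ) / 8))⁻¹ := by positivity
  have h2 : 0 ≤ (x ^ ((11 : ℝ) / 8))⁻¹ * (z ^ ((11 : ℝ) / 8))⁻¹ := by positivity
  have h3 : 0 ≤ (y ^ ((11 : ℝ) / 8))⁻¹ * (z ^ ((11 : ℝ) / 8))⁻¹ := by positivity
  rcases le_total x z with hxz | hzx
  · rcases le_total y z with hyz | hzy
    · -- `z` is the largest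
      have hRz : R ≤ z := by
        rcases le_max_iff.1 hmax with h | h
        · exact h.trans hxz
        · rcases le_max_iff.1 h with h' | h'
          · exact h'.trans hyz
          · exact h'
      have h := klst_inv_mul_three_le_of_le hx hy hR hxz hyz hRz
      nlinarith
    · -- `y` is the largest
      have hRy : R ≤ y := by
        rcases le_max_iff.1 hmax with h | h
        · exact h.trans (hxz.trans hzy)
        · rcases le_max_iff.1 h with h' | h'
          · exact h'
          · exact h'.trans hzy
      have h := klst_inv_mul_three_le_of_le hx hz hR (hxz.trans hzy) hzy hRy
      have he : x * z * y = x * y * z := by ring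
      rw [he] at h
      nlinarith
  · rcases le_total y x with hyx | hxy
    · -- `x` is the largest
      have hRx : R ≤ x := by
        rcases le_max_iff.1 hmax with h | h
        · exact h
        · rcases le_max_iff.1 h with h' | h'
          · exact h'.trans hyx
          · exact h'.trans hzx
      have h := klst_inv_mul_three_le_of_le hy hz hR hyx hzx hRx
      have he : y * z * x = x * y * z := by ring
      rw [he] at h
      nlinarith
    · -- `y` is the largest
      have hRy : R ≤ y := by
        rcases le_max_iff.1 hmax with h | h
        · exact h.trans hxy
        · rcases le_max_iff.1 h with h' | h'
          · exact h'
          · exact h'.trans (hzx.trans hxy)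
      have h := klst_inv_mul_three_le_of_le hx hz hR hxy (hzx.trans hxy) hRy
      have he : x * z * y = x * y * z := by ring
      rw [he] at h
      nlinarith

/-! ## §2 The one-dimensional sum `H = Σ_{a ∈ ℤ} |a + ½|^{-11/8}` -/

/-- **`Σ_{a ∈ ℤ} (|a+½|^{11/8})⁻¹ < ∞`** (a `p`-series with `p = 11/8 > 1`). -/
theorem klst_summable_h : Summable fun a : ℤ => (|(a : ℝ) + 1 / 2| ^ ((11 : ℝ) / 8))⁻¹ := by
  have h := (Real.summable_one_div_int_add_rpow (1 / 2) ((11 : ℝ) / 8)).2 (by norm_num)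
  refine h.congr fun a => ?_
  rw [one_div]

/-- The terms of `H` are nonnegative. -/
theorem klst_h_int_nonneg (a : ℤ) : 0 ≤ (|(a : ℝ) + 1 / 2| ^ ((11 : ℝ) / 8))⁻¹ := by positivity
set_option maxHeartbeats 400000 in
/-- The product family `(a, b) ↦ h(a) h(b)` is summable with sum `H²`. -/
theorem klst_hasSum_prod :
    HasSum (fun ab : ℤ × ℤ => (|(ab.1 : ℝ) + 1 / 2| ^ ((11 : ℝ) / 8))⁻¹ * (|(ab.2 : ℝ) + 1 / 2| ^ ((11 : ℝ) / 8))⁻¹)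
      ((∑' a : ℤ, (|(a : ℝ) + 1 / 2| ^ ((11 : ℝ) / 8))⁻¹) ^ 2) := by
  have hn : Summable fun a : ℤ => ‖(|(a : ℝ) + 1 / 2| ^ ((11 : ℝ) / 8))⁻¹‖ := by
    refine klst_summable_h.congr fun a => ?_
    rw [Real.norm_of_nonneg (klst_h_int_nonneg a)]
  have hs : Summable fun ab : ℤ × ℤ =>
      (|(ab.1 : ℝ) + 1 / 2| ^ ((11 : ℝ) / 8))⁻¹ * (|(ab.2 : ℝ) + 1 / 2| ^ ((11 : ℝ) / 8))⁻¹ :=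
    summable_mul_of_summable_norm hn hn
  rw [sq, tsum_mul_tsum_of_summable_norm hn hn]
  exact hs.hasSum

/-! ## §3 The tail of the two-loop sum, uniformly in the external frequency -/

/-- **The `n`-UNIFORM TAIL of the sunset frequency weight.**  For every external Matsubara integer `n`, every `R > 0` and every
decidable label set `P ⊆ ℤ²` such that on `P` the largest of the three half-integers `|a+½|`, `|b+½|`, `|n+b-a+½|` is at least `R`:
`Σ_{(a,b) ∈ ℤ²} [P(a,b)] · (|a+½| |b+½| |n+b-a+½|)⁻¹ ≤ (R^{1/4})⁻¹ · 3 · (Σ_{a ∈ ℤ} (|a+½|^{11/8})⁻¹)²` — a bound that does not see `n`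
(summability of the indicator family included). -/
theorem klst_tsum_sunsetWeight_indicator_le (n : ℤ) {R : ℝ} (hR : 0 < R) (P : ℤ × ℤ → Prop) [DecidablePred P]
    (hP : ∀ ab : ℤ × ℤ, P ab →
      R ≤ max |(ab.1 : ℝ) + 1 / 2| (max |(ab.2 : ℝ) + 1 / 2| |((n + ab.2 - ab.1 : ℤ) : ℝ) + 1 / 2|)) :
    (Summable fun ab : ℤ × ℤ =>
      if P ab then (|(ab.1 : ℝ) + 1 / 2| * |(ab.2 : ℝ) + 1 / 2| * |((n + ab.2 - ab.1 : ℤ) : ℝ) + 1 / 2|)⁻¹ else 0) ∧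
    ∑' ab : ℤ × ℤ,
        (if P ab then (|(ab.1 : ℝ) + 1 / 2| * |(ab.2 : ℝ) + 1 / 2| * |((n + ab.2 - ab.1 : ℤ) : ℝ) + 1 / 2|)⁻¹ else 0) ≤
      (R ^ ((1 : ℝ) / 4))⁻¹ * (3 * (∑' a : ℤ, (|(a : ℝ) + 1 / 2| ^ ((11 : ℝ) / 8))⁻¹) ^ 2) := by
  -- abbreviations
  set h : ℤ → ℝ := fun a => (|(a : ℝ) + 1 / 2| ^ ((11 : ℝ) / 8))⁻¹ with hh
  set H : ℝ := ∑' a : ℤ, h a with hH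
  have hh0 : ∀ a, 0 ≤ h a := fun a => klst_h_int_nonneg a
  have hRi : 0 ≤ (R ^ ((1 : ℝ) / 4))⁻¹ := by positivity
  -- the three sheared product families, each with sum `H²`
  have hprodHas : HasSum (fun ab : ℤ × ℤ => h ab.1 * h ab.2) (H ^ 2) := klst_hasSum_prod
  have h1Has : HasSum (fun ab : ℤ × ℤ => h ab.1 * h (n + ab.2 - ab.1)) (H ^ 2) :=
    (Equiv.hasSum_iff (Equiv.ofBijective _ (klsf_shear₁_bijective n)) (f := fun uv : ℤ × ℤ => h uv.1 * h uv.2)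
      (a := H ^ 2)).2 hprodHas
  have h2Has : HasSum (fun ab : ℤ × ℤ => h ab.2 * h (n + ab.2 - ab.1)) (H ^ 2) :=
    (Equiv.hasSum_iff (Equiv.ofBijective _ (klsf_shear₂_bijective n)) (f := fun uv : ℤ × ℤ => h uv.1 * h uv.2)
      (a := H ^ 2)).2 hprodHas
  have hsum : HasSum (fun ab : ℤ × ℤ => (R ^ ((1 : ℝ) / 4))⁻¹ *
      (h ab.1 * h ab.2 + h ab.1 * h (n + ab.2 - ab.1) + h ab.2 * h (n + ab.2 - ab.1)))
      ((R ^ ((1 : ℝ) / 4))⁻¹ * (H ^ 2 + H ^ 2 + H ^ 2)) := ((hprodHas.add h1Has).add h2Has).mul_left _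
  -- pointwise domination of the indicator family
  have hle : ∀ ab : ℤ × ℤ,
      (if P ab then (|(ab.1 : ℝ) + 1 / 2| * |(ab.2 : ℝ) + 1 / 2| * |((n + ab.2 - ab.1 : ℤ) : ℝ) + 1 / 2|)⁻¹ else 0) ≤
        (R ^ ((1 : ℝ) / 4))⁻¹ * (h ab.1 * h ab.2 + h ab.1 * h (n + ab.2 - ab.1) + h ab.2 * h (n + ab.2 - ab.1)) := by
    intro ab
    have hrhs : 0 ≤ (R ^ ((1 : ℝ) / 4))⁻¹ *
        (h ab.1 * h ab.2 + h ab.1 * h (n + ab.2 - ab.1) + h ab.2 * h (n + ab.2 - ab.1)) := by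
      have := hh0 ab.1; have := hh0 ab.2; have := hh0 (n + ab.2 - ab.1)
      positivity
    split_ifs with hab
    · exact klst_inv_mul_three_le_of_le_max (klsf_abs_add_half_pos _) (klsf_abs_add_half_pos _) (klsf_abs_add_half_pos _)
        hR (hP ab hab)
    · exact hrhs
  have hnonneg : ∀ ab : ℤ × ℤ,
      0 ≤ (if P ab then (|(ab.1 : ℝ) + 1 / 2| * |(ab.2 : ℝ) + 1 / 2| * |((n + ab.2 - ab.1 : ℤ) : ℝ) + 1 / 2|)⁻¹ else 0) := by
    intro ab
    split_ifs
    · positivity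
    · exact le_rfl
  have hsmb : Summable fun ab : ℤ × ℤ =>
      if P ab then (|(ab.1 : ℝ) + 1 / 2| * |(ab.2 : ℝ) + 1 / 2| * |((n + ab.2 - ab.1 : ℤ) : ℝ) + 1 / 2|)⁻¹ else 0 :=
    Summable.of_nonneg_of_le hnonneg hle hsum.summable
  refine ⟨hsmb, ?_⟩
  calc ∑' ab : ℤ × ℤ,
        (if P ab then (|(ab.1 : ℝ) + 1 / 2| * |(ab.2 : ℝ) + 1 / 2| * |((n + ab.2 - ab.1 : ℤ) : ℝ) + 1 / 2|)⁻¹ else 0)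
      ≤ ∑' ab : ℤ × ℤ, (R ^ ((1 : ℝ) / 4))⁻¹ *
          (h ab.1 * h ab.2 + h ab.1 * h (n + ab.2 - ab.1) + h ab.2 * h (n + ab.2 - ab.1)) :=
        hsmb.tsum_le_tsum hle hsum.summable
    _ = (R ^ ((1 : ℝ) / 4))⁻¹ * (H ^ 2 + H ^ 2 + H ^ 2) := hsum.tsum_eq
    _ = (R ^ ((1 : ℝ) / 4))⁻¹ * (3 * H ^ 2) := by ring

/-- **The whole tail at once**: with `P` = «the largest of the three half-integers is at least `R`». -/
theorem klst_tsum_sunsetWeight_tail_le (n : ℤ) {R : ℝ} (hR : 0 < R) :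
    ∑' ab : ℤ × ℤ,
        (if R ≤ max |(ab.1 : ℝ) + 1 / 2| (max |(ab.2 : ℝ) + 1 / 2| |((n + ab.2 - ab.1 : ℤ) : ℝ) + 1 / 2|) then
          (|(ab.1 : ℝ) + 1 / 2| * |(ab.2 : ℝ) + 1 / 2| * |((n + ab.2 - ab.1 : ℤ) : ℝ) + 1 / 2|)⁻¹ else 0) ≤
      (R ^ ((1 : ℝ) / 4))⁻¹ * (3 * (∑' a : ℤ, (|(a : ℝ) + 1 / 2| ^ ((11 : ℝ) / 8))⁻¹) ^ 2) :=
  (klst_tsum_sunsetWeight_indicator_le n hR _ fun _ hab => hab).2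

/-! ## §4 The bridge to Matsubara cutoffs: a label that is not kept is large -/

/-- **A label outside the kept box `[-M, M-1]` has `|c + ½| ≥ M + ½`.** -/
theorem klst_half_le_abs_of_not_mem_Icc {M : ℕ} {c : ℤ} (hc : c ∉ Finset.Icc (-(M : ℤ)) ((M : ℤ) - 1)) :
    (M : ℝ) + 1 / 2 ≤ |(c : ℝ) + 1 / 2| := by
  rw [Finset.mem_Icc, not_and_or, not_le, not_le] at hc
  rcases hc with h | h
  · -- `c ≤ -M-1`
    have h' : (c : ℝ) ≤ -(M : ℝ) - 1 := by
      have : c ≤ -(M : ℤ) - 1 := by omega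
      exact_mod_cast this
    rw [le_abs]
    right
    linarith
  · -- `c ≥ M`
    have h' : (M : ℝ) ≤ (c : ℝ) := by
      have : (M : ℤ) ≤ c := by omega
      exact_mod_cast this
    rw [le_abs]
    left
    linarith

/-- A kept label has `|c + ½| ≤ M - ½` (converse direction, for the record). -/
theorem klst_abs_le_of_mem_Icc {M : ℕ} {c : ℤ} (hc : c ∈ Finset.Icc (-(M : ℤ)) ((M : ℤ) - 1)) :
    |(c : ℝ) + 1 / 2| ≤ (M : ℝ) - 1 / 2 := by
  rw [Finset.mem_Icc] at hc
  obtain ⟨h1, h2⟩ := hc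
  have h1' : -(M : ℝ) ≤ (c : ℝ) := by exact_mod_cast h1
  have h2' : (c : ℝ) ≤ (M : ℝ) - 1 := by
    have : c ≤ (M : ℤ) - 1 := h2
    exact_mod_cast this
  rw [abs_le]
  constructor <;> linarith

/-- **The tail lemma in cutoff form.**  If on `P` one of the three labels `a`, `b`, `n+b-a` lies outside the kept box of the cutoff `M`, then
`Σ_{(a,b) ∈ P} (|a+½| |b+½| |n+b-a+½|)⁻¹ ≤ ((M+½)^{1/4})⁻¹ · 3H²`, for every `n`. -/
theorem klst_tsum_sunsetWeight_indicator_le_of_cutoff (n : ℤ) (M : ℕ) (P : ℤ × ℤ → Prop) [DecidablePred P]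
    (hP : ∀ ab : ℤ × ℤ, P ab →
      ab.1 ∉ Finset.Icc (-(M : ℤ)) ((M : ℤ) - 1) ∨ ab.2 ∉ Finset.Icc (-(M : ℤ)) ((M : ℤ) - 1) ∨
        n + ab.2 - ab.1 ∉ Finset.Icc (-(M : ℤ)) ((M : ℤ) - 1)) :
    (Summable fun ab : ℤ × ℤ =>
      if P ab then (|(ab.1 : ℝ) + 1 / 2| * |(ab.2 : ℝ) + 1 / 2| * |((n + ab.2 - ab.1 : ℤ) : ℝ) + 1 / 2|)⁻¹ else 0) ∧
    ∑' ab : ℤ × ℤ,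
        (if P ab then (|(ab.1 : ℝ) + 1 / 2| * |(ab.2 : ℝ) + 1 / 2| * |((n + ab.2 - ab.1 : ℤ) : ℝ) + 1 / 2|)⁻¹ else 0) ≤
      ((((M : ℝ) + 1 / 2) ^ ((1 : ℝ) / 4))⁻¹ * (3 * (∑' a : ℤ, (|(a : ℝ) + 1 / 2| ^ ((11 : ℝ) / 8))⁻¹) ^ 2)) := by
  refine klst_tsum_sunsetWeight_indicator_le n (by positivity) P fun ab hab => ?_
  rcases hP ab hab with h | h | h
  · exact le_max_of_le_left (klst_half_le_abs_of_not_mem_Icc h)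
  · exact le_max_of_le_right (le_max_of_le_left (klst_half_le_abs_of_not_mem_Icc h))
  · refine le_max_of_le_right (le_max_of_le_right ?_)
    have h' := klst_half_le_abs_of_not_mem_Icc h
    exact_mod_cast h'

end Summit.HubbardSuperconductivity.HubbardSuperconductivity.Theorems.KLRegimeSplit

end
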